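import Mathlib.Analysis.SpecialFunctions.Gaussian.FourierTransform
import Mathlib.Analysis.Fourier.Inversion
import Mathlib.MeasureTheory.Integral.Prod
import Mathlib.MeasureTheory.Group.Prod
import Mathlib.MeasureTheory.Group.Integral
import Mathlib.MeasureTheory.Function.L2Space
import Mathlib.MeasureTheory.Measure.Haar.Unique
import Mathlib.MeasureTheory.Measure.Haar.InnerProductSpace
import HarnessLib

/-!
# Von Neumann's Gaussian vacuum projection of a Weyl system (the analytic core of the Stone–von Neumann theorem over `ℝ`)

Topic `RepresentationTheory/HeisenbergGroup`; namespace `Literature.RepresentationTheory.HeisenbergGroup`.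

Setting.  `V` is a finite-dimensional real inner product space (phase space) with a compatible complex
structure `J` (`⟪J x, y⟫ = -⟪x, J y⟫`, `‖J x‖ = ‖x‖`), so that `s(x, y) = ⟪x, J y⟫` is a symplectic form; `E` is a
complex Hilbert space and `W : V → (E →L[ℂ] E)` is a **Weyl system**: isometries with continuous orbit maps
satisfying the Weyl form of the canonical commutation relations `W(x) W(y) = e^{iπ s(x,y)} W(x + y)`
(`IsWeylSystem`).  A strongly continuous unitary representation of a real Heisenberg group with the standard
central character is exactly such a system, so everything below is a statement about those.

Contents (all PROVED; Mathlib only; no cited statement is used as a hypothesis):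
* §1 the Gaussian weight `gauss z = e^{-(π/2)‖z‖²}`, two parallelogram identities, and the Gaussian integral
  behind everything, `integral_gauss_mul_gauss_mul_fourierChar`:
  `∫ e^{-(π/2)(‖z-w‖² + ‖y-z‖²)} e^{iπ s(z, w+y)} dz = e^{-(π/2)‖w‖²} e^{-(π/2)‖y‖²}`
  (completing the square + Mathlib's `GaussianFourier.integral_cexp_neg_mul_sq_norm_add`);
* §2 Weyl systems and their algebra (`W 0 = 1`, `W(-x) = W(x)⁻¹ = W(x)†`, conjugation
  `W(a) W(z) W(a)⁻¹ = e^{2iπ s(a,z)} W(z)`);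
* §3 von Neumann's vector-valued Gaussian average **`vacuumVec W u = ∫ e^{-(π/2)‖z‖²} W(z) u dz`** (a Bochner
  integral in `E`) and its three properties: **`vacuumVec_weyl_vacuumVec`** `P W(w) P = e^{-(π/2)‖w‖²} P` (Fubini +
  §1), `inner_vacuumVec_comm` (`P† = P`) and `vacuumVec_vacuumVec` (`P² = P`);
* §4 consequences: a `P`-fixed vector has the FORCED diagonal coefficient
  `⟪W(x) v, v⟫ = e^{-(π/2)‖x‖²} ‖v‖²` (`inner_apply_self_of_vacuumVec_eq`); `P ≠ 0` on `E ≠ 0`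
  (`exists_vacuumVec_ne_zero`, by Fourier inversion applied to `z ↦ e^{-(π/2)‖z‖²} ⟪u, W(z) u⟫`, whose Fourier
  transform at `J a` is `⟪u, W(a) P W(a)⁻¹ u⟫`); hence **`exists_norm_eq_one_inner_apply_self`**: every Weyl system
  on a non-zero Hilbert space has a UNIT VACUUM VECTOR `v`, `⟪W(x) v, v⟫ = e^{-(π/2)‖x‖²}` for all `x`.
With the rigidity of cyclic vectors with equal diagonal coefficients
(`Unitary/CyclicCoefficientRigidity`) this is the uniqueness half of the Stone–von Neumann theorem for the real
Heisenberg group; the present file is model-free.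

Source: J. von Neumann, *Die Eindeutigkeit der Schrödingerschen Operatoren*, Math. Ann. 104 (1931) 570–578
(the operator `A = ∫∫ e^{-¼(α²+β²)} S(α,β) dα dβ` and the identity `A S(u,v) A = e^{-¼(u²+v²)} A`, §4);
G. B. Folland, *Harmonic Analysis in Phase Space*, Annals of Math. Studies 122 (1989), §1.5 Theorem (1.50) and
its proof (the Gaussian `ρ(φ)` with `ρ(φ)ρ(p,q)ρ(φ) = e^{-(π/2)(p²+q²)} ρ(φ)`), whose normalisation
(`h = 1`, `ρ(p,q)ρ(p',q') = e^{iπ(pq' - qp')} ρ(p+p', q+q')`) is the one used here with `s(x,y) = ⟪x, Jy⟫`.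

## References

* [vonNeumann1931] J. von Neumann, Die Eindeutigkeit der Schrödingerschen Operatoren, Math. Ann. 104 (1931)
  570–578, §4.
* [Folland1989] G. B. Folland, *Harmonic Analysis in Phase Space*, Princeton University Press, 1989, §1.3
  (1.25), §1.5 Theorem (1.50) (doi:10.1515/9781400882427).
-/

noncomputable section

open MeasureTheory Complex Filter
open scoped InnerProductSpace FourierTransform ComplexConjugate Topology

namespace Literature.RepresentationTheory.HeisenbergGroup

variable {V : Type*} [NormedAddCommGroup V]
variable {E : Type*} [NormedAddCommGroup E] [InnerProductSpace ℂ E]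

/-! ## 1. The Gaussian weight, parallelogram bookkeeping, and the Gaussian integral -/

/-- The vacuum weight `γ(z) = e^{-(π/2)‖z‖²}` on phase space (the diagonal coefficient of the vacuum of the
Schrödinger representation, Folland (1.72) `β(w)E₀ = e^{-(π/2)|w|²}E_{-w}`). [cite: Folland1989, §1.5 Theorem (1.50)] -/
def gauss (z : V) : ℝ := Real.exp (-(Real.pi / 2) * ‖z‖ ^ 2)

/-- `γ > 0`. [cite: Folland1989, §1.5 proof of Theorem (1.50)] -/
theorem gauss_pos (z : V) : 0 < gauss z := Real.exp_pos _

/-- `γ(0) = 1`. [cite: Folland1989, §1.5 proof of Theorem (1.50)] -/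
@[simp] theorem gauss_zero : gauss (0 : V) = 1 := by simp [gauss]

/-- `γ` is even. [cite: Folland1989, §1.5 proof of Theorem (1.50)] -/
@[simp] theorem gauss_neg (z : V) : gauss (-z) = gauss z := by simp [gauss]

/-- `γ` is continuous. [cite: Folland1989, §1.5 proof of Theorem (1.50)] -/
theorem continuous_gauss : Continuous (gauss : V → ℝ) := by
  unfold gauss; fun_prop

/-- `γ` as a complex exponential. [cite: Folland1989, §1.5 proof of Theorem (1.50)] -/
theorem ofReal_gauss (z : V) : (gauss z : ℂ) = cexp (-(Real.pi / 2) * ‖z‖ ^ 2) := by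
  unfold gauss; push_cast; rfl

/-- `‖(γ z : ℂ)‖ = γ z`. [cite: Folland1989, §1.5 proof of Theorem (1.50)] -/
theorem norm_ofReal_gauss (z : V) : ‖(gauss z : ℂ)‖ = gauss z :=
  Complex.norm_of_nonneg (gauss_pos z).le

/-- `γ(x) γ(y)` as one complex exponential. [cite: Folland1989, §1.5 proof of Theorem (1.50)] -/
theorem ofReal_gauss_mul_ofReal_gauss (x y : V) :
    (gauss x : ℂ) * gauss y = cexp (-(Real.pi / 2) * ‖x‖ ^ 2 + -(Real.pi / 2) * ‖y‖ ^ 2) := by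
  rw [Complex.exp_add, ofReal_gauss, ofReal_gauss]

/-- `𝐞(r) 𝐞(s) = 𝐞(r + s)` in `ℂ`. [cite: Folland1989, §1.5 proof of Theorem (1.50)] -/
theorem fourierChar_coe_mul (r s : ℝ) :
    ((𝐞 r : Circle) : ℂ) * ((𝐞 s : Circle) : ℂ) = ((𝐞 (r + s) : Circle) : ℂ) := by
  rw [AddChar.map_add_eq_mul, Circle.coe_mul]

/-- `𝐞(r/2) = e^{iπr}`. [cite: Folland1989, §1.5 proof of Theorem (1.50)] -/
theorem fourierChar_half_coe (r : ℝ) : ((𝐞 (r / 2) : Circle) : ℂ) = cexp (Real.pi * r * I) := by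
  rw [Real.fourierChar_apply]
  congr 1
  push_cast
  ring

variable [InnerProductSpace ℝ V]

/-- The parallelogram bookkeeping behind "completing the square": with `m = ½(w + y)`,
`‖z + m - w‖² + ‖y - (z + m)‖² = 2‖z‖² + ½‖y - w‖²`. [cite: Folland1989, §1.5 proof of Theorem (1.50)] -/
theorem norm_sq_add_norm_sq_shift (z w y : V) :
    ‖z + (1 / 2 : ℝ) • (w + y) - w‖ ^ 2 + ‖y - (z + (1 / 2 : ℝ) • (w + y))‖ ^ 2 =
      2 * ‖z‖ ^ 2 + (1 / 2) * ‖y - w‖ ^ 2 := by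
  set d : V := (1 / 2 : ℝ) • (y - w) with hd
  have e1 : z + (1 / 2 : ℝ) • (w + y) - w = z + d := by rw [hd]; module
  have e2 : y - (z + (1 / 2 : ℝ) • (w + y)) = d - z := by rw [hd]; module
  have e3 : ‖d‖ ^ 2 = (1 / 4) * ‖y - w‖ ^ 2 := by
    rw [hd, norm_smul, mul_pow, Real.norm_of_nonneg (by norm_num)]; norm_num
  rw [e1, e2, norm_add_sq_real, norm_sub_sq_real, real_inner_comm z d, e3]
  ring

/-- The parallelogram law in the form `‖y - w‖² + ‖w + y‖² = 2‖w‖² + 2‖y‖²`. [cite: Folland1989, §1.5 proof of Theorem (1.50)] -/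
theorem norm_sub_sq_add_norm_add_sq (w y : V) :
    ‖y - w‖ ^ 2 + ‖w + y‖ ^ 2 = 2 * ‖w‖ ^ 2 + 2 * ‖y‖ ^ 2 := by
  rw [norm_sub_sq_real, norm_add_sq_real, real_inner_comm w y]
  ring

/-- `⟪x, J x⟫ = 0` for a skew `J`. [cite: Folland1989, §1.5 proof of Theorem (1.50)] -/
theorem inner_J_self {J : V →ₗ[ℝ] V} (hJ : ∀ x y : V, ⟪J x, y⟫_ℝ = -⟪x, J y⟫_ℝ) (x : V) :
    ⟪x, J x⟫_ℝ = 0 := by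
  have h1 := hJ x x
  have h2 : ⟪x, J x⟫_ℝ = ⟪J x, x⟫_ℝ := real_inner_comm _ _
  linarith

/-- antisymmetry of `s(x, y) = ⟪x, J y⟫`. [cite: Folland1989, §1.5 proof of Theorem (1.50)] -/
theorem inner_J_swap {J : V →ₗ[ℝ] V} (hJ : ∀ x y : V, ⟪J x, y⟫_ℝ = -⟪x, J y⟫_ℝ) (x y : V) :
    ⟪y, J x⟫_ℝ = -⟪x, J y⟫_ℝ := by
  rw [← hJ x y]
  exact real_inner_comm _ _

section Measure

variable [FiniteDimensional ℝ V] [MeasurableSpace V] [BorelSpace V]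

/-- `γ` is integrable (it is a Gaussian on a finite-dimensional inner product space). [cite: Folland1989, §1.5 proof of Theorem (1.50)] -/
theorem integrable_gauss : Integrable (gauss : V → ℝ) := by
  have h := (GaussianFourier.integrable_cexp_neg_mul_sq_norm_add (V := V) (b := ((Real.pi / 2 : ℝ) : ℂ))
    (by rw [Complex.ofReal_re]; positivity) 0 0).norm
  refine h.congr (Eventually.of_forall fun z => ?_)
  simp only [zero_mul, add_zero]
  rw [show -((Real.pi / 2 : ℝ) : ℂ) * (‖z‖ : ℂ) ^ 2 = ((-(Real.pi / 2) * ‖z‖ ^ 2 : ℝ) : ℂ) by push_cast; ring,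
    Complex.norm_exp_ofReal]
  rfl

/-- A continuous function dominated by a translate of `γ` is integrable. [cite: Folland1989, §1.5 proof of Theorem (1.50)] -/
theorem integrable_of_norm_le_gauss {F : Type*} [NormedAddCommGroup F] {f : V → F} (hf : Continuous f)
    (w : V) (C : ℝ) (h : ∀ z, ‖f z‖ ≤ C * gauss (z - w)) : Integrable f :=
  Integrable.mono' ((integrable_gauss.comp_sub_right w).const_mul C) hf.aestronglyMeasurable
    (Eventually.of_forall h)

/-- **The Gaussian integral behind von Neumann's identity** (completing the square, then Mathlib's Gaussian
integral with a linear phase): for a skew isometry `J`,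
`∫ γ(z - w) 𝐞(½⟪z, J w⟫) γ(y - z) 𝐞(½⟪z, J y⟫) dz = γ(w) γ(y)`.
[cite: Folland1989, §1.5 proof of Theorem (1.50)] -/
theorem integral_gauss_mul_gauss_mul_fourierChar {J : V →ₗ[ℝ] V} (hJ : ∀ x y : V, ⟪J x, y⟫_ℝ = -⟪x, J y⟫_ℝ)
    (hJn : ∀ x : V, ‖J x‖ = ‖x‖) (w y : V) :
    ∫ z : V, (gauss (z - w) : ℂ) * ((𝐞 (⟪z, J w⟫_ℝ / 2) : Circle) : ℂ) *
        ((gauss (y - z) : ℂ) * ((𝐞 (⟪z, J y⟫_ℝ / 2) : Circle) : ℂ)) = (gauss w : ℂ) * gauss y := by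
  set m : V := (1 / 2 : ℝ) • (w + y) with hm
  set F : V → ℂ := fun z => (gauss (z - w) : ℂ) * ((𝐞 (⟪z, J w⟫_ℝ / 2) : Circle) : ℂ) *
    ((gauss (y - z) : ℂ) * ((𝐞 (⟪z, J y⟫_ℝ / 2) : Circle) : ℂ)) with hF
  have hπ : (Real.pi : ℂ) ≠ 0 := Complex.ofReal_ne_zero.mpr Real.pi_ne_zero
  -- the exponent bookkeeping at the shifted variable `z + m`
  have hpt : ∀ z : V, F (z + m) = cexp (-(Real.pi / 4) * ‖y - w‖ ^ 2) *
      cexp (-(Real.pi : ℂ) * ‖z‖ ^ 2 + (Real.pi * I) * ⟪J (w + y), z⟫_ℝ) := by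
    intro z
    have hR := norm_sq_add_norm_sq_shift z w y
    have hI : ⟪z + m, J w⟫_ℝ + ⟪z + m, J y⟫_ℝ = ⟪J (w + y), z⟫_ℝ := by
      rw [← inner_add_right, ← map_add, inner_add_left, hm, real_inner_smul_left, inner_J_self hJ,
        mul_zero, add_zero, real_inner_comm]
    have hRc : ((‖z + m - w‖ : ℂ) ^ 2 + (‖y - (z + m)‖ : ℂ) ^ 2) =
        2 * (‖z‖ : ℂ) ^ 2 + (1 / 2) * (‖y - w‖ : ℂ) ^ 2 := by
      have h := congrArg (fun r : ℝ => (r : ℂ)) hR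
      push_cast at h
      rw [hm]
      linear_combination h
    have hIc : ((⟪z + m, J w⟫_ℝ : ℝ) : ℂ) + ((⟪z + m, J y⟫_ℝ : ℝ) : ℂ) = ((⟪J (w + y), z⟫_ℝ : ℝ) : ℂ) := by
      exact_mod_cast hI
    simp only [hF, ofReal_gauss, fourierChar_half_coe]
    rw [← Complex.exp_add, ← Complex.exp_add, ← Complex.exp_add, ← Complex.exp_add]
    congr 1
    linear_combination (-(Real.pi : ℂ) / 2) * hRc + ((Real.pi : ℂ) * I) * hIc
  have h4 : (Real.pi * I) ^ 2 * (‖w + y‖ : ℂ) ^ 2 / (4 * Real.pi) = -(Real.pi / 4) * (‖w + y‖ : ℂ) ^ 2 := by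
    rw [mul_pow, I_sq]
    field_simp
  have hP : ((‖y - w‖ : ℂ) ^ 2 + (‖w + y‖ : ℂ) ^ 2) = 2 * (‖w‖ : ℂ) ^ 2 + 2 * (‖y‖ : ℂ) ^ 2 := by
    exact_mod_cast norm_sub_sq_add_norm_add_sq w y
  rw [← integral_add_right_eq_self F m]
  simp_rw [hpt]
  rw [integral_const_mul, GaussianFourier.integral_cexp_neg_mul_sq_norm_add (b := (Real.pi : ℂ))
      (by rw [Complex.ofReal_re]; exact Real.pi_pos) (Real.pi * I) (J (w + y)), hJn, div_self hπ,
    Complex.one_cpow, one_mul, h4, ofReal_gauss_mul_ofReal_gauss, ← Complex.exp_add]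
  congr 1
  linear_combination (-(Real.pi : ℂ) / 4) * hP

end Measure

/-! ## 2. Weyl systems -/

/-- A **Weyl system** over the phase space `(V, J)` on the Hilbert space `E`: `J` is a compatible complex
structure (skew and isometric, so `s(x,y) = ⟪x, Jy⟫` is a symplectic form) and `W : V → 𝓑(E)` consists of
isometries with continuous orbit maps satisfying the integrated canonical commutation relations
`W(x) W(y) = 𝐞(½ s(x,y)) W(x + y)` (Folland's `ρ(p,q)ρ(p',q') = e^{iπ(pq' - qp')}ρ(p+p', q+q')` at `h = 1`).
[cite: Folland1989, §1.3 (1.25) and §1.5 Theorem (1.50)] -/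
structure IsWeylSystem (J : V →ₗ[ℝ] V) (W : V → E →L[ℂ] E) : Prop where
  /-- `J` is skew-adjoint. -/
  inner_J_left : ∀ x y : V, ⟪J x, y⟫_ℝ = -⟪x, J y⟫_ℝ
  /-- `J` is isometric. -/
  norm_J : ∀ x : V, ‖J x‖ = ‖x‖
  /-- the Weyl relations. -/
  mul : ∀ (x y : V) (u : E), W x (W y u) = ((𝐞 (⟪x, J y⟫_ℝ / 2) : Circle) : ℂ) • W (x + y) u
  /-- each `W x` is an isometry. -/
  norm_map : ∀ (x : V) (u : E), ‖W x u‖ = ‖u‖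
  /-- strong continuity. -/
  continuous : ∀ u : E, Continuous fun x => W x u

namespace IsWeylSystem

variable {J : V →ₗ[ℝ] V} {W : V → E →L[ℂ] E}

/-- `⟪x, J x⟫ = 0`. [cite: Folland1989, §1.5 proof of Theorem (1.50)] -/
theorem inner_J_self (hW : IsWeylSystem J W) (x : V) : ⟪x, J x⟫_ℝ = 0 :=
  HeisenbergGroup.inner_J_self hW.inner_J_left x

/-- antisymmetry of `⟪·, J ·⟫`. [cite: Folland1989, §1.5 proof of Theorem (1.50)] -/
theorem inner_J_swap (hW : IsWeylSystem J W) (x y : V) : ⟪y, J x⟫_ℝ = -⟪x, J y⟫_ℝ :=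
  HeisenbergGroup.inner_J_swap hW.inner_J_left x y

/-- `J` is onto (an isometry of a finite-dimensional space). [cite: Folland1989, §1.5 proof of Theorem (1.50)] -/
theorem surjective_J [FiniteDimensional ℝ V] (hW : IsWeylSystem J W) : Function.Surjective J := by
  refine LinearMap.surjective_of_injective fun x y hxy => ?_
  have h : ‖J (x - y)‖ = 0 := by rw [map_sub, hxy, sub_self, norm_zero]
  rw [hW.norm_J, norm_eq_zero, sub_eq_zero] at h
  exact h

/-- `W(0) = 1`: `W(0)` is an isometric idempotent. [cite: Folland1989, §1.3 (1.25)–(1.26)] -/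
@[simp] theorem apply_zero (hW : IsWeylSystem J W) (u : E) : W 0 u = u := by
  have h1 : W 0 (W 0 u) = W 0 u := by
    rw [hW.mul]; simp
  have h2 : ‖W 0 u - u‖ = 0 := by
    rw [← hW.norm_map 0, map_sub, h1, sub_self, norm_zero]
  rwa [norm_eq_zero, sub_eq_zero] at h2

/-- `W(-x) W(x) = 1`. [cite: Folland1989, §1.3 (1.25)–(1.26)] -/
theorem apply_neg_apply (hW : IsWeylSystem J W) (x : V) (u : E) : W (-x) (W x u) = u := by
  rw [hW.mul]; simp [hW.inner_J_self, hW.apply_zero]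

/-- `W(x) W(-x) = 1`. [cite: Folland1989, §1.3 (1.25)–(1.26)] -/
theorem apply_apply_neg (hW : IsWeylSystem J W) (x : V) (u : E) : W x (W (-x) u) = u := by
  rw [hW.mul]; simp [hW.inner_J_self, hW.apply_zero]

/-- `W(x)` preserves inner products. [cite: Folland1989, §1.3 (1.25)–(1.26)] -/
theorem inner_apply_apply (hW : IsWeylSystem J W) (x : V) (u v : E) : ⟪W x u, W x v⟫_ℂ = ⟪u, v⟫_ℂ :=
  LinearIsometry.inner_map_map (⟨(W x : E →ₗ[ℂ] E), hW.norm_map x⟩ : E →ₗᵢ[ℂ] E) u v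

/-- `W(x)† = W(-x)`, left form. [cite: Folland1989, §1.3 (1.25)–(1.26)] -/
theorem inner_apply_left (hW : IsWeylSystem J W) (x : V) (u v : E) :
    ⟪W x u, v⟫_ℂ = ⟪u, W (-x) v⟫_ℂ := by
  conv_lhs => rw [← hW.apply_apply_neg x v]
  exact hW.inner_apply_apply x u (W (-x) v)

/-- `W(x)† = W(-x)`, right form. [cite: Folland1989, §1.3 (1.25)–(1.26)] -/
theorem inner_apply_right (hW : IsWeylSystem J W) (x : V) (u v : E) :
    ⟪u, W x v⟫_ℂ = ⟪W (-x) u, v⟫_ℂ := by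
  rw [hW.inner_apply_left, neg_neg]

/-- conjugation: `W(a) W(z) W(a)⁻¹ = 𝐞(⟪a, J z⟫) W(z)`. [cite: Folland1989, §1.3 (1.25)] -/
theorem apply_apply_apply_neg (hW : IsWeylSystem J W) (a z : V) (u : E) :
    W a (W z (W (-a) u)) = ((𝐞 (⟪a, J z⟫_ℝ) : Circle) : ℂ) • W z u := by
  have hs : ⟪z, J (-a)⟫_ℝ / 2 + ⟪a, J (z + -a)⟫_ℝ / 2 = ⟪a, J z⟫_ℝ := by
    simp only [map_neg, map_add, inner_neg_right, inner_add_right, hW.inner_J_self, hW.inner_J_swap a z]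
    ring
  rw [hW.mul z (-a) u, map_smul, hW.mul a (z + -a) u, smul_smul, fourierChar_coe_mul, hs,
    show a + (z + -a) = z by abel]

/-- `z ↦ γ(z) ⟪u, W(z) u⟫` is continuous. [cite: Folland1989, §1.5 proof of Theorem (1.50)] -/
theorem continuous_gauss_mul_inner (hW : IsWeylSystem J W) (u : E) :
    Continuous fun z : V => (gauss z : ℂ) * ⟪u, W z u⟫_ℂ :=
  (continuous_ofReal.comp continuous_gauss).mul (continuous_const.inner (hW.continuous u))

end IsWeylSystem

/-! ## 3. The Gaussian average: integrability, covariance, `P W(w) P = γ(w) P`, `P† = P = P²` -/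

section Measure

variable [FiniteDimensional ℝ V] [MeasurableSpace V] [BorelSpace V]

/-- **von Neumann's Gaussian average** `P u = ∫ e^{-(π/2)‖z‖²} W(z) u dz` (a Bochner integral in `E`; for a
Weyl system it is the orthogonal projection onto the vacuum vectors).
[cite: vonNeumann1931, §4; Folland1989, §1.5 proof of Theorem (1.50)] -/
def vacuumVec (W : V → E →L[ℂ] E) (u : E) : E := ∫ z : V, (gauss z : ℂ) • W z u

/-- `P` is homogeneous. [cite: Folland1989, §1.5 proof of Theorem (1.50)] -/
theorem vacuumVec_smul (W : V → E →L[ℂ] E) (c : ℂ) (u : E) :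
    vacuumVec W (c • u) = c • vacuumVec W u := by
  unfold vacuumVec
  rw [← integral_smul]
  congr 1
  funext z
  rw [map_smul, smul_comm]

namespace IsWeylSystem

variable {J : V →ₗ[ℝ] V} {W : V → E →L[ℂ] E}

/-- Integrands `φ(z) • W(z) u` with `|φ| ≤ C γ(· - w)` are Bochner integrable. [cite: Folland1989, §1.5 proof of Theorem (1.50)] -/
theorem integrable_smul_apply (hW : IsWeylSystem J W) (u : E) {φ : V → ℂ} (hφ : Continuous φ) (w : V)
    (C : ℝ) (h : ∀ z, ‖φ z‖ ≤ C * gauss (z - w)) : Integrable fun z => φ z • W z u := by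
  refine integrable_of_norm_le_gauss (hφ.smul (hW.continuous u)) w (C * ‖u‖) fun z => ?_
  rw [norm_smul, hW.norm_map]
  calc ‖φ z‖ * ‖u‖ ≤ C * gauss (z - w) * ‖u‖ := mul_le_mul_of_nonneg_right (h z) (norm_nonneg u)
    _ = C * ‖u‖ * gauss (z - w) := by ring

/-- the defining integrand of `vacuumVec` is integrable. [cite: Folland1989, §1.5 proof of Theorem (1.50)] -/
theorem integrable_gauss_smul_apply (hW : IsWeylSystem J W) (u : E) :
    Integrable fun z : V => (gauss z : ℂ) • W z u :=
  hW.integrable_smul_apply u (continuous_ofReal.comp continuous_gauss) 0 1 fun z => by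
    rw [sub_zero, one_mul]
    exact (norm_ofReal_gauss z).le

/-- joint integrability of the double integrand of `P W(w) P u` (dominated by `‖u‖ γ(z-w) γ(y-z)`, an
integrable function of `(z, y)` by the shear `(z, y) ↦ (z, y - z)`). [cite: Folland1989, §1.5 proof of Theorem (1.50)] -/
theorem integrable_uncurry (hW : IsWeylSystem J W) (w : V) (u : E) :
    Integrable (Function.uncurry fun z y : V =>
      ((gauss (z - w) : ℂ) * ((𝐞 (⟪z, J w⟫_ℝ / 2) : Circle) : ℂ) *
        ((gauss (y - z) : ℂ) * ((𝐞 (⟪z, J y⟫_ℝ / 2) : Circle) : ℂ))) • W y u)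
      ((volume : Measure V).prod volume) := by
  have hJc : Continuous J := J.continuous_of_finiteDimensional
  have hg : Continuous fun z : V => (gauss z : ℂ) := continuous_ofReal.comp continuous_gauss
  have hc : Continuous fun p : V × V =>
      ((gauss (p.1 - w) : ℂ) * ((𝐞 (⟪p.1, J w⟫_ℝ / 2) : Circle) : ℂ) *
        ((gauss (p.2 - p.1) : ℂ) * ((𝐞 (⟪p.1, J p.2⟫_ℝ / 2) : Circle) : ℂ))) • W p.2 u := by
    refine Continuous.smul ?_ ((hW.continuous u).comp continuous_snd)
    exact ((hg.comp (continuous_fst.sub continuous_const)).mul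
      ((continuous_subtype_val.comp Real.continuous_fourierChar).comp ((continuous_fst.inner continuous_const).div_const _))).mul
      ((hg.comp (continuous_snd.sub continuous_fst)).mul
        ((continuous_subtype_val.comp Real.continuous_fourierChar).comp ((continuous_fst.inner (hJc.comp continuous_snd)).div_const _)))
  refine Integrable.mono' (g := fun p : V × V => ‖u‖ * (gauss (p.1 - w) * gauss (p.2 - p.1))) ?_
    hc.aestronglyMeasurable (Eventually.of_forall fun p => ?_)
  · have h1 : Integrable (fun p : V × V => gauss (p.1 - w) * gauss p.2)
        ((volume : Measure V).prod volume) :=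
      (integrable_gauss.comp_sub_right w).mul_prod integrable_gauss
    have h2 := ((measurePreserving_prod_sub (volume : Measure V) (volume : Measure V)).integrable_comp
      h1.aestronglyMeasurable).mpr h1
    exact h2.const_mul ‖u‖
  · rcases p with ⟨z, y⟩
    simp only [Function.uncurry_apply_pair, norm_smul, norm_mul, Circle.norm_coe, norm_ofReal_gauss,
      hW.norm_map, mul_one]
    exact le_of_eq (by ring)

/-- `z ↦ γ(z) ⟪u, W(z) u⟫` is integrable. [cite: Folland1989, §1.5 proof of Theorem (1.50)] -/
theorem integrable_gauss_mul_inner (hW : IsWeylSystem J W) (u : E) :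
    Integrable fun z : V => (gauss z : ℂ) * ⟪u, W z u⟫_ℂ :=
  integrable_of_norm_le_gauss (hW.continuous_gauss_mul_inner u) 0 (‖u‖ * ‖u‖) fun z => by
    rw [norm_mul, norm_ofReal_gauss, sub_zero, mul_comm]
    refine mul_le_mul_of_nonneg_right ((norm_inner_le_norm u _).trans ?_) (gauss_pos z).le
    rw [hW.norm_map]

/-- `P W(w) v` as a single Gaussian integral: `∫ γ(z - w) 𝐞(½⟪z, J w⟫) W(z) v dz`.
[cite: Folland1989, §1.5 proof of Theorem (1.50)] -/
theorem vacuumVec_apply (hW : IsWeylSystem J W) (w : V) (v : E) :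
    vacuumVec W (W w v) =
      ∫ z : V, ((gauss (z - w) : ℂ) * ((𝐞 (⟪z, J w⟫_ℝ / 2) : Circle) : ℂ)) • W z v := by
  unfold vacuumVec
  set F : V → E := fun x : V => ((gauss (x - w) : ℂ) * ((𝐞 (⟪x, J w⟫_ℝ / 2) : Circle) : ℂ)) • W x v
    with hF
  have h : (fun z : V => (gauss z : ℂ) • W z (W w v)) = fun z => F (z + w) := by
    funext z
    simp only [hF, add_sub_cancel_right, hW.mul z w v, smul_smul, inner_add_left, hW.inner_J_self,
      add_zero]
  rw [h, integral_add_right_eq_self F w]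

variable [CompleteSpace E]

/-- `W(z) P u` as a single Gaussian integral: `∫ γ(y - z) 𝐞(½⟪z, J y⟫) W(y) u dy`.
[cite: Folland1989, §1.5 proof of Theorem (1.50)] -/
theorem apply_vacuumVec (hW : IsWeylSystem J W) (z : V) (u : E) :
    W z (vacuumVec W u) =
      ∫ y : V, ((gauss (y - z) : ℂ) * ((𝐞 (⟪z, J y⟫_ℝ / 2) : Circle) : ℂ)) • W y u := by
  unfold vacuumVec
  rw [← (W z).integral_comp_comm (hW.integrable_gauss_smul_apply u)]
  set F : V → E := fun x : V => ((gauss (x - z) : ℂ) * ((𝐞 (⟪z, J x⟫_ℝ / 2) : Circle) : ℂ)) • W x u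
    with hF
  have h : (fun y : V => W z ((gauss y : ℂ) • W y u)) = fun y => F (z + y) := by
    funext y
    simp only [hF, map_smul, hW.mul z y u, smul_smul, add_sub_cancel_left, map_add, inner_add_right,
      hW.inner_J_self, zero_add]
  rw [h, integral_add_left_eq_self F z]

/-- **von Neumann's identity `P W(w) P = e^{-(π/2)‖w‖²} P`** (on vectors: `P (W(w) (P u)) = γ(w) • P u`).
Proof: write both `P W(w)` and `W(z) P` as single Gaussian integrals, exchange the order of integration
(Fubini for Bochner integrals) and evaluate the inner scalar integral by `integral_gauss_mul_gauss_mul_fourierChar`.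
[cite: vonNeumann1931, §4; Folland1989, §1.5 proof of Theorem (1.50)] -/
theorem vacuumVec_weyl_vacuumVec (hW : IsWeylSystem J W) (w : V) (u : E) :
    vacuumVec W (W w (vacuumVec W u)) = (gauss w : ℂ) • vacuumVec W u := by
  rw [hW.vacuumVec_apply]
  simp_rw [hW.apply_vacuumVec, ← integral_smul, smul_smul]
  rw [integral_integral_swap (hW.integrable_uncurry w u)]
  simp_rw [integral_smul_const, integral_gauss_mul_gauss_mul_fourierChar hW.inner_J_left hW.norm_J,
    ← smul_smul]
  rw [integral_smul]
  rfl

/-- `⟪u, P v⟫ = ∫ γ(z) ⟪u, W(z) v⟫ dz`. [cite: Folland1989, §1.5 proof of Theorem (1.50)] -/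
theorem inner_vacuumVec_right (hW : IsWeylSystem J W) (u v : E) :
    ⟪u, vacuumVec W v⟫_ℂ = ∫ z : V, (gauss z : ℂ) * ⟪u, W z v⟫_ℂ := by
  unfold vacuumVec
  rw [← integral_inner (hW.integrable_gauss_smul_apply v)]
  simp_rw [inner_smul_right]

/-- `⟪P u, v⟫ = ∫ γ(z) ⟪W(z) u, v⟫ dz`. [cite: Folland1989, §1.5 proof of Theorem (1.50)] -/
theorem inner_vacuumVec_left (hW : IsWeylSystem J W) (u v : E) :
    ⟪vacuumVec W u, v⟫_ℂ = ∫ z : V, (gauss z : ℂ) * ⟪W z u, v⟫_ℂ := by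
  rw [← inner_conj_symm, hW.inner_vacuumVec_right, ← integral_conj]
  congr 1
  funext z
  rw [map_mul, Complex.conj_ofReal, inner_conj_symm]

/-- **`P† = P`**: `γ` is even and `W(z)† = W(-z)`. [cite: Folland1989, §1.5 proof of Theorem (1.50)] -/
theorem inner_vacuumVec_comm (hW : IsWeylSystem J W) (u v : E) :
    ⟪vacuumVec W u, v⟫_ℂ = ⟪u, vacuumVec W v⟫_ℂ := by
  rw [hW.inner_vacuumVec_left, hW.inner_vacuumVec_right]
  simp_rw [hW.inner_apply_right]
  conv_rhs => rw [← integral_neg_eq_self]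
  simp only [neg_neg, gauss_neg]

/-- **`P² = P`** (the case `w = 0` of von Neumann's identity). [cite: vonNeumann1931, §4] -/
theorem vacuumVec_vacuumVec (hW : IsWeylSystem J W) (u : E) :
    vacuumVec W (vacuumVec W u) = vacuumVec W u := by
  simpa [hW.apply_zero] using hW.vacuumVec_weyl_vacuumVec 0 u

/-! ## 4. Vacuum vectors: the forced diagonal coefficient, and existence -/

/-- **The diagonal coefficient of a `P`-fixed vector is forced**: `⟪W(x) v, v⟫ = e^{-(π/2)‖x‖²} ‖v‖²`.
[cite: Folland1989, §1.5 proof of Theorem (1.50)] -/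
theorem inner_apply_self_of_vacuumVec_eq (hW : IsWeylSystem J W) {v : E} (hv : vacuumVec W v = v)
    (x : V) : ⟪W x v, v⟫_ℂ = (gauss x : ℂ) * ‖v‖ ^ 2 := by
  calc ⟪W x v, v⟫_ℂ = ⟪W x v, vacuumVec W v⟫_ℂ := by rw [hv]
    _ = ⟪vacuumVec W (W x v), v⟫_ℂ := (hW.inner_vacuumVec_comm _ _).symm
    _ = ⟪vacuumVec W (W x (vacuumVec W v)), v⟫_ℂ := by rw [hv]
    _ = ⟪(gauss x : ℂ) • vacuumVec W v, v⟫_ℂ := by rw [hW.vacuumVec_weyl_vacuumVec]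
    _ = (gauss x : ℂ) * ‖v‖ ^ 2 := by
        rw [hv, inner_smul_left, Complex.conj_ofReal, inner_self_eq_norm_sq_to_K]
        rfl

/-- `⟪u, W(a) P W(a)⁻¹ u⟫` is the Fourier transform of `z ↦ γ(z) ⟪u, W(z) u⟫` at `J a`.
[cite: Folland1989, §1.5 proof of Theorem (1.50)] -/
theorem inner_apply_vacuumVec_apply_neg (hW : IsWeylSystem J W) (a : V) (u : E) :
    ⟪u, W a (vacuumVec W (W (-a) u))⟫_ℂ = 𝓕 (fun z : V => (gauss z : ℂ) * ⟪u, W z u⟫_ℂ) (J a) := by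
  have hint : Integrable fun z : V => ((gauss z : ℂ) * ((𝐞 (⟪a, J z⟫_ℝ) : Circle) : ℂ)) • W z u :=
    hW.integrable_smul_apply u ((continuous_ofReal.comp continuous_gauss).mul
      ((continuous_subtype_val.comp Real.continuous_fourierChar).comp (continuous_const.inner J.continuous_of_finiteDimensional))) 0 1
      fun z => by rw [norm_mul, norm_ofReal_gauss, Circle.norm_coe, mul_one, sub_zero, one_mul]
  unfold vacuumVec
  rw [← (W a).integral_comp_comm (hW.integrable_gauss_smul_apply _)]
  simp_rw [map_smul, hW.apply_apply_apply_neg, smul_smul]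
  rw [Real.fourier_eq, ← integral_inner hint]
  congr 1
  funext z
  rw [inner_smul_right, Circle.smul_def, smul_eq_mul, hW.inner_J_swap z a]
  ring

/-- **`P ≠ 0` on a non-zero Hilbert space.**  If `P = 0` then all the conjugates `W(a) P W(a)⁻¹` vanish, so the
Fourier transform of the continuous integrable function `z ↦ γ(z)⟪u, W(z)u⟫` vanishes identically (`J` is onto);
by Fourier inversion the function is zero, and its value at `0` is `‖u‖²`.
[cite: vonNeumann1931, §4; Folland1989, §1.5 proof of Theorem (1.50)] -/
theorem exists_vacuumVec_ne_zero [Nontrivial E] (hW : IsWeylSystem J W) : ∃ u : E, vacuumVec W u ≠ 0 := by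
  by_contra h
  push Not at h
  obtain ⟨u, hu⟩ := exists_ne (0 : E)
  have hFG : 𝓕 (fun z : V => (gauss z : ℂ) * ⟪u, W z u⟫_ℂ) = 0 := by
    funext ξ
    obtain ⟨a, rfl⟩ := hW.surjective_J ξ
    rw [Pi.zero_apply, ← hW.inner_apply_vacuumVec_apply_neg, h, map_zero, inner_zero_right]
  have hinv := (hW.continuous_gauss_mul_inner u).fourierInv_fourier_eq (hW.integrable_gauss_mul_inner u)
    (by rw [hFG]; exact integrable_zero _ _ _)
  rw [hFG] at hinv
  have h0 : (fun z : V => (gauss z : ℂ) * ⟪u, W z u⟫_ℂ) 0 = 0 := by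
    rw [← hinv, Real.fourierInv_eq]
    simp
  have h1 : (fun z : V => (gauss z : ℂ) * ⟪u, W z u⟫_ℂ) 0 = (‖u‖ : ℂ) ^ 2 := by
    simp only [gauss_zero, Complex.ofReal_one, one_mul, hW.apply_zero, inner_self_eq_norm_sq_to_K]
    norm_cast
  rw [h1] at h0
  exact hu (by simpa using h0)

/-- **Existence of a unit vacuum vector**: every Weyl system on a non-zero Hilbert space has a `P`-fixed unit
vector, and its diagonal coefficient is the Gaussian `⟪W(x) v, v⟫ = e^{-(π/2)‖x‖²}` — the coefficient of the
vacuum of the Schrödinger representation. [cite: vonNeumann1931, §4; Folland1989, §1.5 Theorem (1.50)] -/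
theorem exists_norm_eq_one_inner_apply_self [Nontrivial E] (hW : IsWeylSystem J W) :
    ∃ v : E, ‖v‖ = 1 ∧ vacuumVec W v = v ∧ ∀ x : V, ⟪W x v, v⟫_ℂ = (gauss x : ℂ) := by
  obtain ⟨u, hu⟩ := hW.exists_vacuumVec_ne_zero
  have hfix : vacuumVec W (vacuumVec W u) = vacuumVec W u := hW.vacuumVec_vacuumVec u
  have hn : ‖vacuumVec W u‖ ≠ 0 := norm_ne_zero_iff.mpr hu
  have hfix' : vacuumVec W (((‖vacuumVec W u‖⁻¹ : ℝ) : ℂ) • vacuumVec W u) =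
      ((‖vacuumVec W u‖⁻¹ : ℝ) : ℂ) • vacuumVec W u := by
    rw [vacuumVec_smul, hfix]
  refine ⟨((‖vacuumVec W u‖⁻¹ : ℝ) : ℂ) • vacuumVec W u, ?_, hfix', fun x => ?_⟩
  · rw [norm_smul, Complex.norm_real, norm_inv, norm_norm, inv_mul_cancel₀ hn]
  · rw [hW.inner_apply_self_of_vacuumVec_eq hfix', norm_smul, Complex.norm_real, norm_inv, norm_norm,
      inv_mul_cancel₀ hn]
    simp

end IsWeylSystem

end Measure

end Literature.RepresentationTheory.HeisenbergGroup

end
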